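import Literature.Analysis.FunctionSpaces.CompactCutoffExtension   -- ★ `contDiff_smul_of_tsupport_subset` (localisation by a cut-off is globally smooth)
import HarnessLib

/-!
# Symmetric germs near a diagonal point: the product cut-off and the germ form of Glaeser-type theorems

Topic `Analysis/Calculus`; namespace `Literature.Analysis.Calculus`.  THEOREMS ONLY (no `def`, no
instance, no notation, no axiom, no named fact, no `sorry`); imports: Mathlib (through the ★ support
file `Literature.Analysis.FunctionSpaces.CompactCutoffExtension`, whose `contDiff_smul_of_tsupport_subset`
is reused rather than restated).

Brick **B10 «GERM∕BALL COROLLARY»** of the in-house Glaeser–Chevalley road for `S₃` (cell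
`pub/hodgecm-mathlib`, N8-census §5 (9); road memo `F0/P3c/LH7/LH7-p01/g6/SIGFIRST-Glaeser3.v1.md`
§1, road G″; binder LH7-p01 (g6), this brick F0P3a-p09 (g9)).  The GLOBAL theorem («a smooth
function of three real variables and a parameter, symmetric in the variables, is a smooth function
of their elementary symmetric polynomials and the parameter», G. Glaeser 1963 for `n = 3`) is the
binder's head `exists_contDiff_comp_esymm_three_of_forall_perm`; here we derive from ANY such global
statement its GERM form at a diagonal point `(t, …, t)`: a function smooth and symmetric only on a
sup-norm ball round the diagonal point (such balls are permutation invariant) is, on a smaller ball,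
a smooth function of the invariants.  The global statement enters as an explicit hypothesis
`hglobal` (the shape of the binder's conclusion, verbatim), so this file imports nothing of the road
and the binder instantiates it.

* §1 `exists_contDiff_prod_cutoff` — the symmetric product cut-off `χ(x) = ∏ᵢ φ(xᵢ)` (`φ` a smooth
  bump at `t`): smooth, `= 1` on the sup-ball of radius `r'`, supported in the sup-ball of radius
  `r`, invariant under permutations of the coordinates (any `n`);
* §2 `contDiff_smul_fst_of_tsupport_subset` — extension by zero with a parameter: `χ(x) • f(x, z)`
  is globally smooth when `f` is smooth on `U × P` and `tsupport χ ⊆ U` (generic, no symmetry; a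
  corollary of ★ `Literature.Analysis.FunctionSpaces.contDiff_smul_of_tsupport_subset`);
* §3 `exists_contDiff_comp_of_forall_perm_ball` — generic germ transfer for any `n` and any
  invariant map `π`;
* §4 `exists_contDiff_comp_esymm_three_of_forall_perm_ball` — the head: memo §1's ball form for
  `n = 3`, `π x = (e₁, e₂, e₃)(x)`.

## References

* [Glaeser1963Newton] G. Glaeser, *Fonctions composées différentiables*, Ann. of Math. (2) 77 (1963)
  193–209, Thm. II («théorème de Newton différentiable»); author's summary: Sém. Lelong (Analyse) 5
  (1962/63), exp. 2, p. 4.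
* [GolubitskyGuillemin1973] M. Golubitsky, V. Guillemin, *Stable Mappings and Their Singularities*,
  GTM 14, Springer (1973), Ch. IV §3 Example (B) (the local form at a diagonal point; «it is easy to
  see how to make this equality a global one» — the cut-off of §1 is that passage in either direction).

HONEST LABEL: count-neutral calculus plumbing; pays no organ by itself (HC_CM is proved only modulo
the printed citations until rung 0 closes).
-/

noncomputable section

open Set Function Filter Metric Topology
open scoped ContDiff

namespace Literature.Analysis.Calculus

/-! ### §1 The symmetric product cut-off -/

/-- **Symmetric product cut-off round a diagonal point.**  For `0 < r' < r` there is a smooth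
`χ : (Fin n → ℝ) → ℝ` with `χ = 1` on the sup-norm ball of radius `r'` about `(t, …, t)`, with
`tsupport χ` inside the sup-norm ball of radius `r`, and invariant under all permutations of the
coordinates (`χ(x) = ∏ᵢ φ(xᵢ)` for a smooth bump `φ` at `t`) — the cut-off that passes between the
local and the global form of the smooth Newton theorem.
[cite: GolubitskyGuillemin1973, Ch. IV §3 Example (B) («it is easy to see how to make this equality a global one»)] -/
theorem exists_contDiff_prod_cutoff (n : ℕ) (t : ℝ) {r' r : ℝ} (hr' : 0 < r') (hr : r' < r) :
    ∃ χ : (Fin n → ℝ) → ℝ, ContDiff ℝ ∞ χ ∧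
      (∀ x ∈ ball (fun _ : Fin n => t) r', χ x = 1) ∧
      tsupport χ ⊆ ball (fun _ : Fin n => t) r ∧
      ∀ (σ : Equiv.Perm (Fin n)) (x : Fin n → ℝ), χ (x ∘ σ) = χ x := by
  have hmid : r' < (r' + r) / 2 := by linarith
  have hmid' : (r' + r) / 2 < r := by linarith
  have hmid0 : 0 < (r' + r) / 2 := by linarith
  let φ : ContDiffBump t := ⟨r', (r' + r) / 2, hr', hmid⟩
  refine ⟨fun x => ∏ i, φ (x i), ?_, ?_, ?_, ?_⟩
  · exact contDiff_prod fun i _ => φ.contDiff.comp (contDiff_apply ℝ ℝ i)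
  · intro x hx
    rw [mem_ball, dist_pi_lt_iff hr'] at hx
    exact Finset.prod_eq_one fun i _ =>
      φ.one_of_mem_closedBall (mem_closedBall.2 (le_of_lt (hx i)))
  · -- the support lies in the sup-ball of radius `(r' + r)/2`, whose closure lies in the ball of
    -- radius `r`
    have hsupp : support (fun x : Fin n → ℝ => ∏ i, φ (x i)) ⊆ ball (fun _ : Fin n => t) ((r' + r) / 2) := by
      intro x hx
      rw [mem_support] at hx
      rw [mem_ball, dist_pi_lt_iff hmid0]
      intro i
      have hi : φ (x i) ≠ 0 := (Finset.prod_ne_zero_iff.1 hx) i (Finset.mem_univ i)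
      have : x i ∈ support (φ : ℝ → ℝ) := mem_support.2 hi
      rw [φ.support_eq] at this
      exact mem_ball.1 this
    calc tsupport (fun x : Fin n → ℝ => ∏ i, φ (x i))
        ⊆ closure (ball (fun _ : Fin n => t) ((r' + r) / 2)) := closure_mono hsupp
      _ ⊆ closedBall (fun _ : Fin n => t) ((r' + r) / 2) := closure_ball_subset_closedBall
      _ ⊆ ball (fun _ : Fin n => t) r := closedBall_subset_ball hmid'
  · intro σ x
    exact Equiv.prod_comp σ (fun i => φ (x i))

/-! ### §2 Extension by zero of a cut-off function smooth on an open set -/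

section ExtensionByZero

variable {X : Type*} [NormedAddCommGroup X] [NormedSpace ℝ X]
  {P : Type*} [NormedAddCommGroup P] [NormedSpace ℝ P]
  {E : Type*} [NormedAddCommGroup E] [NormedSpace ℝ E]

/-- **Extension by zero, with a parameter.**  If `f` is `C^∞` on `U × P` (`U` open) and `χ` is a
smooth scalar function of the first variable with `tsupport χ ⊆ U`, then `(x, z) ↦ χ(x) • f(x, z)` is
`C^∞` on the whole space (★ `Literature.Analysis.FunctionSpaces.contDiff_smul_of_tsupport_subset`
applied on the open set `U × P` to the cut-off `χ ∘ fst`).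
[cite: GolubitskyGuillemin1973, Ch. IV §3 Example (B)] -/
theorem contDiff_smul_fst_of_tsupport_subset {U : Set X} (hU : IsOpen U) {χ : X → ℝ}
    (hχ : ContDiff ℝ ∞ χ) (hχU : tsupport χ ⊆ U) {f : X × P → E}
    (hf : ContDiffOn ℝ ∞ f (U ×ˢ univ)) :
    ContDiff ℝ ∞ fun q : X × P => χ q.1 • f q := by
  have h1 : tsupport (fun q : X × P => χ q.1) ⊆ Prod.fst ⁻¹' tsupport χ :=
    closure_minimal (fun q hq => subset_tsupport _ (mem_support.2 (mem_support.1 hq)))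
      ((isClosed_tsupport χ).preimage continuous_fst)
  have h2 : tsupport (fun q : X × P => χ q.1) ⊆ U ×ˢ univ := by
    rw [prod_univ]; exact h1.trans (preimage_mono hχU)
  exact Literature.Analysis.FunctionSpaces.contDiff_smul_of_tsupport_subset (hU.prod isOpen_univ)
    (hχ.comp contDiff_fst) h2 hf

end ExtensionByZero

/-! ### §3 Generic germ transfer -/

variable {P : Type*} [NormedAddCommGroup P] [NormedSpace ℝ P]
  {E : Type*} [NormedAddCommGroup E] [NormedSpace ℝ E]

/-- **Germ transfer for symmetric functions (any number of variables, any invariant map).**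
Suppose that every globally smooth `F : (Fin n → ℝ) × P → E` symmetric in the `n` real variables
factors as `F(x, z) = g(π x, z)` with `g` smooth (`hglobal`).  Then a function `f` that is smooth and
symmetric only on a sup-norm ball round a diagonal point `(t, …, t)` (times the parameter space)
factors in the same way on a smaller such ball.  Proof: multiply `f` by the symmetric product cut-off
of §1 and apply `hglobal` to the (globally smooth, globally symmetric) product.
[cite: GolubitskyGuillemin1973, Ch. IV §3 Example (B)] [cite: Glaeser1963Newton, Thm. II (théorème de Newton différentiable)] -/
theorem exists_contDiff_comp_of_forall_perm_ball {n : ℕ} {Y : Type*} [NormedAddCommGroup Y]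
    [NormedSpace ℝ Y] (π : (Fin n → ℝ) → Y)
    (hglobal : ∀ F : (Fin n → ℝ) × P → E, ContDiff ℝ ∞ F →
      (∀ (σ : Equiv.Perm (Fin n)) (x : Fin n → ℝ) (z : P), F (x ∘ σ, z) = F (x, z)) →
      ∃ g : Y × P → E, ContDiff ℝ ∞ g ∧ ∀ (x : Fin n → ℝ) (z : P), F (x, z) = g (π x, z))
    (f : (Fin n → ℝ) × P → E) (t : ℝ) {r : ℝ} (hr : 0 < r)
    (hf : ContDiffOn ℝ ∞ f (ball (fun _ => t) r ×ˢ univ))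
    (hsymm : ∀ (σ : Equiv.Perm (Fin n)), ∀ x ∈ ball (fun _ : Fin n => t) r, ∀ z : P,
      f (x ∘ σ, z) = f (x, z)) :
    ∃ g : Y × P → E, ContDiff ℝ ∞ g ∧ ∃ r' > 0,
      ∀ x ∈ ball (fun _ : Fin n => t) r', ∀ z : P, f (x, z) = g (π x, z) := by
  have hr2 : 0 < r / 2 := half_pos hr
  obtain ⟨χ, hχ, hχ1, hχU, hχσ⟩ := exists_contDiff_prod_cutoff n t hr2 (half_lt_self hr)
  -- the cut-off product, extended by zero
  set F : (Fin n → ℝ) × P → E := fun q => χ q.1 • f q with hF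
  have hFc : ContDiff ℝ ∞ F := contDiff_smul_fst_of_tsupport_subset isOpen_ball hχ hχU hf
  have hFσ : ∀ (σ : Equiv.Perm (Fin n)) (x : Fin n → ℝ) (z : P), F (x ∘ σ, z) = F (x, z) := by
    intro σ x z
    simp only [hF, hχσ σ x]
    by_cases hx : x ∈ ball (fun _ : Fin n => t) r
    · rw [hsymm σ x hx z]
    · have hx0 : χ x = 0 := by
        by_contra h
        exact hx (hχU (subset_tsupport _ (mem_support.2 h)))
      rw [hx0, zero_smul, zero_smul]
  obtain ⟨g, hg, hgF⟩ := hglobal F hFc hFσ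
  refine ⟨g, hg, r / 2, hr2, fun x hx z => ?_⟩
  rw [← hgF x z, hF]
  simp only [hχ1 x hx, one_smul]

/-! ### §4 The head: the germ form of Glaeser–Chevalley for `S₃` -/

/-- **Glaeser–Chevalley for `S₃`, germ form at a diagonal point** (road memo §1, ball form; the
global theorem — G. Glaeser (1963), «théorème de Newton différentiable», `n = 3`, with parameters
and Banach values — enters as the hypothesis `hglobal`, the conclusion-shape of the binder's head
`exists_contDiff_comp_esymm_three_of_forall_perm`).  A function `f : (Fin 3 → ℝ) × P → E` smooth on
a sup-norm ball round `(t, t, t)` (times `P`) and symmetric there is, on a smaller such ball, a smooth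
function of `e₁ = x₀ + x₁ + x₂`, `e₂ = x₀x₁ + x₀x₂ + x₁x₂`, `e₃ = x₀x₁x₂` and the parameter.
[cite: Glaeser1963Newton, Thm. II (théorème de Newton différentiable; Sém. Lelong 5 (1962/63) exp. 2 p. 4)] [cite: GolubitskyGuillemin1973, Ch. IV §3 Example (B)] -/
theorem exists_contDiff_comp_esymm_three_of_forall_perm_ball
    (hglobal : ∀ f : (Fin 3 → ℝ) × P → E, ContDiff ℝ ∞ f →
      (∀ (σ : Equiv.Perm (Fin 3)) (x : Fin 3 → ℝ) (z : P), f (x ∘ σ, z) = f (x, z)) →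
      ∃ g : (Fin 3 → ℝ) × P → E, ContDiff ℝ ∞ g ∧ ∀ (x : Fin 3 → ℝ) (z : P),
        f (x, z) = g (![x 0 + x 1 + x 2, x 0 * x 1 + x 0 * x 2 + x 1 * x 2, x 0 * x 1 * x 2], z))
    (f : (Fin 3 → ℝ) × P → E) (t : ℝ) {r : ℝ} (hr : 0 < r)
    (hf : ContDiffOn ℝ ∞ f (Metric.ball (fun _ => t) r ×ˢ Set.univ))
    (hsymm : ∀ (σ : Equiv.Perm (Fin 3)), ∀ x ∈ Metric.ball (fun _ : Fin 3 => t) r, ∀ z : P,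
      f (x ∘ σ, z) = f (x, z)) :
    ∃ g : (Fin 3 → ℝ) × P → E, ContDiff ℝ ∞ g ∧ ∃ r' > 0,
      ∀ x ∈ Metric.ball (fun _ : Fin 3 => t) r', ∀ z : P,
        f (x, z) = g (![x 0 + x 1 + x 2, x 0 * x 1 + x 0 * x 2 + x 1 * x 2, x 0 * x 1 * x 2], z) :=
  exists_contDiff_comp_of_forall_perm_ball
    (fun x : Fin 3 → ℝ => ![x 0 + x 1 + x 2, x 0 * x 1 + x 0 * x 2 + x 1 * x 2, x 0 * x 1 * x 2])
    hglobal f t hr hf hsymm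

end Literature.Analysis.Calculus

end
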